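import Summits.ValiantsHypothesis.ValiantsHypothesis.Theorems.BarrierLeverPartitionMinorsYOnlyFactor
import Summits.ValiantsHypothesis.ValiantsHypothesis.Theorems.BarrierLeverPartitionMinorsGenericChowProduct

/-!
# Route BarrierLever — item `ChowHitsThinRowPartitionMinors` (stmt-ValiantsHypothesis-20195):
# indicator-form products and their leave-one-out coefficients (prelims for the sub-cube slice, I)

Helper file (`--supports stmt-ValiantsHypothesis-20195`; cell valiant-natproofs, rung V4, 𝒟-side of
door (c); prover seat valiant-natproofs-prover gen 10).  Closes NO item; imports only the seat
val-np-p4 infrastructure files `…PartitionMinorsYOnlyFactor` / `…PartitionMinorsGenericChowProduct`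
(no route file).  Companions: `…ChowThinRowsSubcubeBasis` (independence, positivity, packaging) and
`…ChowThinRowsSubcube` (the slice theorem).

Conventions of items 19717 / 20172 / 20195: `x_a = X (castAdd h a)`, `y_c = X (natAdd h c)` in
`MvPolynomial (Fin (h+h)) ℂ`; the partition-matrix entry of `f` at `(u, w)` is `coeff (E u w) f`,
`E u w = Σ_{a ∈ u} single (castAdd h a) 1 + Σ_{c ∈ w} single (natAdd h c) 1`.

The witness family is the product of INDICATOR FORMS `φ_V = C 1 + Σ_a C (κ a V) · x_a + Σ_c C [c ∈ V] · y_c`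
over a Finset `𝒦` of subsets `V`.  Here:
* `coeff_empty_mul_form` / `coeff_single_mul_form` — the partition-coefficient recursions for
  appending one `φ_V` (from `ChowFactor.coeff_partitionExpo_mul_affine`), at rows `∅` and `{a}`;
* `coeff_empty_prod_eq` — the `x`-parts `κ` do not affect the `x`-free coefficients;
  `coeff_empty_empty_prod` — the constant coefficient is `1`;
* `coeff_single_prod` — DERIVATIVE FORMULA: `coeff (E {a} W) ∏_𝒦 φ = Σ_{V ∈ 𝒦} κ a V · coeff (E ∅ W) ∏_{𝒦∖V} φ`;
* `coeff_tinv`, `coeff_tinv_mul_form0` — the TRUNCATED INVERSE `t_V = Σ_{U ⊆ V} (-1)^{|U|} |U|! · y^U`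
  satisfies `t_V · φ⁰_V ≡ 1` on squarefree monomials (`(-1)^n n! + n (-1)^{n-1} (n-1)! = 0`);
* `coeff_leaveOneOut` — CLOSED FORM: for `V ∈ 𝒦`, on squarefree monomials the leave-one-out product
  `∏_{𝒦 ∖ V} φ⁰` equals `(∏_𝒦 φ⁰) · t_V` (val-np-p3's «inverse products in `ℂ[y]/(y_c²)`», planner
  g14's MEMO-thinrows §1d inversion `(-1)^{|w'|} |w'|!`, made polynomial-exact).

WHAT THIS IS NOT: bookkeeping only; nothing here on items 20195 / 20172 / 19717 themselves, on crux
stmt-ValiantsHypothesis-14610, or on `VP` versus `VNP`.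
-/

set_option linter.dupNamespace false

namespace Summit.ValiantsHypothesis.ValiantsHypothesis.Theorems.BarrierLever.ChowSubcube

open Finset MvPolynomial
open Summit.ValiantsHypothesis.ValiantsHypothesis.Theorems.BarrierLever.ChowFactor
  (coeff_partitionExpo_mul_affine coeff_partitionExpo_mul_yOnly totalDegree_affine_le)
open Summit.ValiantsHypothesis.ValiantsHypothesis.Theorems.BarrierLever.ProductStateSums
  (castAdd_ne_natAdd partitionExpo_apply_castAdd partitionExpo_apply_natAdd)
open Summit.ValiantsHypothesis.ValiantsHypothesis.Theorems.BarrierLever.CorankRepair (partitionExpo_eq_iff)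

variable {h : ℕ}

/-! ## 1. Products of the indicator forms `φ_V = 1 + Σ_a κ_a(V) x_a + Σ_{c ∈ V} y_c` -/

/-- **Recursion for the `x`-free partition coefficients** of `(∏_{V' ∈ 𝒦} φ_{V'}) · φ_V`:
`coeff (E ∅ W) (F · φ_V) = coeff (E ∅ W) F + Σ_{c ∈ W, c ∈ V} coeff (E ∅ (W.erase c)) F`. -/
theorem coeff_empty_mul_form (F : MvPolynomial (Fin (h + h)) ℂ) (κV : Fin h → ℂ)
    (V W : Finset (Fin h)) :
    coeff (∑ a ∈ (∅ : Finset (Fin h)), Finsupp.single (Fin.castAdd h a) 1 +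
        ∑ c ∈ W, Finsupp.single (Fin.natAdd h c) 1)
        (F * (C 1 + ∑ a, C (κV a) * X (Fin.castAdd h a) +
          ∑ c, C (if c ∈ V then (1 : ℂ) else 0) * X (Fin.natAdd h c))) =
      coeff (∑ a ∈ (∅ : Finset (Fin h)), Finsupp.single (Fin.castAdd h a) 1 +
          ∑ c ∈ W, Finsupp.single (Fin.natAdd h c) 1) F +
        ∑ c ∈ W with c ∈ V, coeff (∑ a ∈ (∅ : Finset (Fin h)), Finsupp.single (Fin.castAdd h a) 1 +
          ∑ c' ∈ W.erase c, Finsupp.single (Fin.natAdd h c') 1) F := by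
  classical
  rw [coeff_partitionExpo_mul_affine, one_mul]
  simp only [Finset.sum_empty, add_zero, zero_add]
  rw [Finset.sum_filter]
  congr 1
  refine Finset.sum_congr rfl fun c _ => ?_
  split_ifs <;> simp

/-- **Recursion for the first-order partition coefficients**:
`coeff (E {a} W) (F · φ_V) = coeff (E {a} W) F + κ_a(V) · coeff (E ∅ W) F
  + Σ_{c ∈ W, c ∈ V} coeff (E {a} (W.erase c)) F`. -/
theorem coeff_single_mul_form (F : MvPolynomial (Fin (h + h)) ℂ) (κV : Fin h → ℂ)
    (V W : Finset (Fin h)) (a : Fin h) :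
    coeff (∑ a' ∈ ({a} : Finset (Fin h)), Finsupp.single (Fin.castAdd h a') 1 +
        ∑ c ∈ W, Finsupp.single (Fin.natAdd h c) 1)
        (F * (C 1 + ∑ a, C (κV a) * X (Fin.castAdd h a) +
          ∑ c, C (if c ∈ V then (1 : ℂ) else 0) * X (Fin.natAdd h c))) =
      coeff (∑ a' ∈ ({a} : Finset (Fin h)), Finsupp.single (Fin.castAdd h a') 1 +
          ∑ c ∈ W, Finsupp.single (Fin.natAdd h c) 1) F +
        κV a * coeff (∑ a' ∈ (∅ : Finset (Fin h)), Finsupp.single (Fin.castAdd h a') 1 +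
          ∑ c ∈ W, Finsupp.single (Fin.natAdd h c) 1) F +
        ∑ c ∈ W with c ∈ V, coeff (∑ a' ∈ ({a} : Finset (Fin h)), Finsupp.single (Fin.castAdd h a') 1 +
          ∑ c' ∈ W.erase c, Finsupp.single (Fin.natAdd h c') 1) F := by
  classical
  rw [coeff_partitionExpo_mul_affine, one_mul]
  simp only [Finset.sum_singleton, Finset.erase_singleton, Finset.sum_empty, zero_add]
  rw [Finset.sum_filter]
  congr 1
  refine Finset.sum_congr rfl fun c _ => ?_
  split_ifs <;> simp

/-- The constant partition coefficient of such a product is `1`. -/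
theorem coeff_empty_empty_prod (κ : Fin h → Finset (Fin h) → ℂ) (𝒦 : Finset (Finset (Fin h))) :
    coeff (∑ a ∈ (∅ : Finset (Fin h)), Finsupp.single (Fin.castAdd h a) 1 +
        ∑ c ∈ (∅ : Finset (Fin h)), Finsupp.single (Fin.natAdd h c) 1)
        (∏ V ∈ 𝒦, (C 1 + ∑ a, C (κ a V) * X (Fin.castAdd h a) +
          ∑ c, C (if c ∈ V then (1 : ℂ) else 0) * X (Fin.natAdd h c))) = 1 := by
  classical
  induction 𝒦 using Finset.induction_on with
  | empty =>
    rw [Finset.prod_empty]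
    simp
  | insert V 𝒦 hV ih =>
    rw [Finset.prod_insert hV, mul_comm, coeff_empty_mul_form, ih]
    simp

/-- **The `x`-parts do not affect the `x`-free partition coefficients.** -/
theorem coeff_empty_prod_eq (κ κ' : Fin h → Finset (Fin h) → ℂ) (𝒦 : Finset (Finset (Fin h)))
    (W : Finset (Fin h)) :
    coeff (∑ a ∈ (∅ : Finset (Fin h)), Finsupp.single (Fin.castAdd h a) 1 +
        ∑ c ∈ W, Finsupp.single (Fin.natAdd h c) 1)
        (∏ V ∈ 𝒦, (C 1 + ∑ a, C (κ a V) * X (Fin.castAdd h a) +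
          ∑ c, C (if c ∈ V then (1 : ℂ) else 0) * X (Fin.natAdd h c))) =
      coeff (∑ a ∈ (∅ : Finset (Fin h)), Finsupp.single (Fin.castAdd h a) 1 +
          ∑ c ∈ W, Finsupp.single (Fin.natAdd h c) 1)
        (∏ V ∈ 𝒦, (C 1 + ∑ a, C (κ' a V) * X (Fin.castAdd h a) +
          ∑ c, C (if c ∈ V then (1 : ℂ) else 0) * X (Fin.natAdd h c))) := by
  classical
  induction 𝒦 using Finset.induction_on generalizing W with
  | empty => rw [Finset.prod_empty, Finset.prod_empty]
  | insert V 𝒦 hV ih =>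
    rw [Finset.prod_insert hV, Finset.prod_insert hV, mul_comm, coeff_empty_mul_form,
      mul_comm, coeff_empty_mul_form]
    simp only [ih]

/-- **Derivative formula**: the first-order coefficient `coeff (E {a} W)` of the product over `𝒦` is
`Σ_{V ∈ 𝒦} κ_a(V) · coeff (E ∅ W) (leave-V-out product)`. -/
theorem coeff_single_prod (κ : Fin h → Finset (Fin h) → ℂ) (𝒦 : Finset (Finset (Fin h)))
    (a : Fin h) (W : Finset (Fin h)) :
    coeff (∑ a' ∈ ({a} : Finset (Fin h)), Finsupp.single (Fin.castAdd h a') 1 +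
        ∑ c ∈ W, Finsupp.single (Fin.natAdd h c) 1)
        (∏ V ∈ 𝒦, (C 1 + ∑ a, C (κ a V) * X (Fin.castAdd h a) +
          ∑ c, C (if c ∈ V then (1 : ℂ) else 0) * X (Fin.natAdd h c))) =
      ∑ V ∈ 𝒦, κ a V *
        coeff (∑ a' ∈ (∅ : Finset (Fin h)), Finsupp.single (Fin.castAdd h a') 1 +
            ∑ c ∈ W, Finsupp.single (Fin.natAdd h c) 1)
          (∏ V' ∈ 𝒦.erase V, (C 1 + ∑ a, C (κ a V') * X (Fin.castAdd h a) +
            ∑ c, C (if c ∈ V' then (1 : ℂ) else 0) * X (Fin.natAdd h c))) := by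
  classical
  induction 𝒦 using Finset.induction_on generalizing W with
  | empty =>
    rw [Finset.prod_empty, Finset.sum_empty, coeff_one, if_neg]
    intro h0
    have := DFunLike.congr_fun h0 (Fin.castAdd h a)
    rw [partitionExpo_apply_castAdd] at this
    simp at this
  | insert V 𝒦 hV ih =>
    rw [Finset.prod_insert hV, mul_comm, coeff_single_mul_form, ih, Finset.sum_insert hV,
      Finset.erase_insert hV]
    -- the leave-one-out products for `V' ∈ 𝒦`
    have herase : ∀ V' ∈ 𝒦, (insert V 𝒦).erase V' = insert V (𝒦.erase V') := by
      intro V' hV'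
      rw [Finset.erase_insert_of_ne]
      rintro rfl
      exact hV hV'
    have hstep : ∀ V' ∈ 𝒦,
        coeff (∑ a' ∈ (∅ : Finset (Fin h)), Finsupp.single (Fin.castAdd h a') 1 +
            ∑ c ∈ W, Finsupp.single (Fin.natAdd h c) 1)
          (∏ V'' ∈ (insert V 𝒦).erase V', (C 1 + ∑ a, C (κ a V'') * X (Fin.castAdd h a) +
            ∑ c, C (if c ∈ V'' then (1 : ℂ) else 0) * X (Fin.natAdd h c))) =
        coeff (∑ a' ∈ (∅ : Finset (Fin h)), Finsupp.single (Fin.castAdd h a') 1 +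
            ∑ c ∈ W, Finsupp.single (Fin.natAdd h c) 1)
          (∏ V'' ∈ 𝒦.erase V', (C 1 + ∑ a, C (κ a V'') * X (Fin.castAdd h a) +
            ∑ c, C (if c ∈ V'' then (1 : ℂ) else 0) * X (Fin.natAdd h c))) +
        ∑ c ∈ W with c ∈ V, coeff (∑ a' ∈ (∅ : Finset (Fin h)), Finsupp.single (Fin.castAdd h a') 1 +
            ∑ c' ∈ W.erase c, Finsupp.single (Fin.natAdd h c') 1)
          (∏ V'' ∈ 𝒦.erase V', (C 1 + ∑ a, C (κ a V'') * X (Fin.castAdd h a) +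
            ∑ c, C (if c ∈ V'' then (1 : ℂ) else 0) * X (Fin.natAdd h c))) := by
      intro V' hV'
      have hVn : V ∉ 𝒦.erase V' := fun hm => hV (Finset.mem_of_mem_erase hm)
      rw [herase V' hV', Finset.prod_insert hVn, mul_comm, coeff_empty_mul_form]
    have hR : (∑ V' ∈ 𝒦, κ a V' *
        coeff (∑ a' ∈ (∅ : Finset (Fin h)), Finsupp.single (Fin.castAdd h a') 1 +
            ∑ c ∈ W, Finsupp.single (Fin.natAdd h c) 1)
          (∏ V'' ∈ (insert V 𝒦).erase V', (C 1 + ∑ a, C (κ a V'') * X (Fin.castAdd h a) +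
            ∑ c, C (if c ∈ V'' then (1 : ℂ) else 0) * X (Fin.natAdd h c)))) =
        ∑ V' ∈ 𝒦, κ a V' *
          (coeff (∑ a' ∈ (∅ : Finset (Fin h)), Finsupp.single (Fin.castAdd h a') 1 +
              ∑ c ∈ W, Finsupp.single (Fin.natAdd h c) 1)
            (∏ V'' ∈ 𝒦.erase V', (C 1 + ∑ a, C (κ a V'') * X (Fin.castAdd h a) +
              ∑ c, C (if c ∈ V'' then (1 : ℂ) else 0) * X (Fin.natAdd h c))) +
          ∑ c ∈ W with c ∈ V, coeff (∑ a' ∈ (∅ : Finset (Fin h)), Finsupp.single (Fin.castAdd h a') 1 +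
              ∑ c' ∈ W.erase c, Finsupp.single (Fin.natAdd h c') 1)
            (∏ V'' ∈ 𝒦.erase V', (C 1 + ∑ a, C (κ a V'') * X (Fin.castAdd h a) +
              ∑ c, C (if c ∈ V'' then (1 : ℂ) else 0) * X (Fin.natAdd h c)))) :=
      Finset.sum_congr rfl fun V' hV' => by rw [hstep V' hV']
    rw [hR]
    simp only [ih, mul_add, Finset.sum_add_distrib, Finset.mul_sum]
    rw [Finset.sum_comm]
    ring

/-! ## 2. The leave-one-out products of the `y`-parts: closed form via the truncated inverse -/

/-- A product of two `y`-only polynomials is `y`-only. -/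
theorem yOnly_mul {p q : MvPolynomial (Fin (h + h)) ℂ}
    (hp : ∀ s ∈ p.support, ∀ a : Fin h, s (Fin.castAdd h a) = 0)
    (hq : ∀ s ∈ q.support, ∀ a : Fin h, s (Fin.castAdd h a) = 0) :
    ∀ s ∈ (p * q).support, ∀ a : Fin h, s (Fin.castAdd h a) = 0 := by
  classical
  intro s hs a
  obtain ⟨s₁, hs₁, s₂, hs₂, rfl⟩ := Finset.mem_add.mp (support_mul p q hs)
  rw [Finsupp.add_apply, hp s₁ hs₁ a, hq s₂ hs₂ a]

/-- A sum of `y`-only polynomials is `y`-only. -/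
theorem yOnly_add {p q : MvPolynomial (Fin (h + h)) ℂ}
    (hp : ∀ s ∈ p.support, ∀ a : Fin h, s (Fin.castAdd h a) = 0)
    (hq : ∀ s ∈ q.support, ∀ a : Fin h, s (Fin.castAdd h a) = 0) :
    ∀ s ∈ (p + q).support, ∀ a : Fin h, s (Fin.castAdd h a) = 0 := by
  classical
  intro s hs a
  rcases Finset.mem_union.mp (support_add hs) with h1 | h2
  · exact hp s h1 a
  · exact hq s h2 a

/-- A finite sum of `y`-only polynomials is `y`-only. -/
theorem yOnly_sum {ι : Type*} (S : Finset ι) (f : ι → MvPolynomial (Fin (h + h)) ℂ)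
    (hf : ∀ i ∈ S, ∀ s ∈ (f i).support, ∀ a : Fin h, s (Fin.castAdd h a) = 0) :
    ∀ s ∈ (∑ i ∈ S, f i).support, ∀ a : Fin h, s (Fin.castAdd h a) = 0 := by
  classical
  intro s hs a
  obtain ⟨i, hi, hs'⟩ := Finset.mem_biUnion.mp (support_sum hs)
  exact hf i hi s hs' a

/-- A monomial with an `x`-free exponent is `y`-only. -/
theorem yOnly_monomial (m : Fin (h + h) →₀ ℕ) (r : ℂ) (hm : ∀ a : Fin h, m (Fin.castAdd h a) = 0) :
    ∀ s ∈ (monomial m r : MvPolynomial (Fin (h + h)) ℂ).support, ∀ a : Fin h,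
      s (Fin.castAdd h a) = 0 := by
  classical
  intro s hs a
  rw [Finset.mem_singleton.mp (support_monomial_subset hs)]
  exact hm a

/-- The `y`-part `φ⁰_V = C 1 + Σ_a C 0 · x_a + Σ_c C [c ∈ V] · y_c` is `y`-only. -/
theorem yOnly_form0 (V : Finset (Fin h)) :
    ∀ s ∈ (C 1 + ∑ a, C ((fun (_ : Fin h) (_ : Finset (Fin h)) => (0 : ℂ)) a V) * X (Fin.castAdd h a) +
        ∑ c, C (if c ∈ V then (1 : ℂ) else 0) * X (Fin.natAdd h c) :
          MvPolynomial (Fin (h + h)) ℂ).support, ∀ a : Fin h, s (Fin.castAdd h a) = 0 := by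
  classical
  refine yOnly_add (yOnly_add ?_ ?_) ?_
  · rw [C_apply]
    exact yOnly_monomial 0 1 fun a => rfl
  · refine yOnly_sum _ _ fun a' _ => ?_
    rw [C_0, zero_mul]
    intro s hs
    simp at hs
  · refine yOnly_sum _ _ fun c _ => ?_
    rw [C_mul_X_eq_monomial]
    refine yOnly_monomial _ _ fun a => ?_
    rw [Finsupp.single_apply, if_neg (castAdd_ne_natAdd a c).symm]

/-- Coefficients of the **truncated inverse** `t_V = Σ_{U ⊆ V} (-1)^{|U|} |U|! · y^U`:
`coeff (E ∅ U') t_V = [U' ⊆ V] · (-1)^{|U'|} |U'|!`. -/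
theorem coeff_tinv (V U' : Finset (Fin h)) :
    coeff (∑ a ∈ (∅ : Finset (Fin h)), Finsupp.single (Fin.castAdd h a) 1 +
        ∑ c ∈ U', Finsupp.single (Fin.natAdd h c) 1)
        (∑ U ∈ V.powerset, monomial (∑ a ∈ (∅ : Finset (Fin h)), Finsupp.single (Fin.castAdd h a) 1 +
          ∑ c ∈ U, Finsupp.single (Fin.natAdd h c) 1) ((-1 : ℂ) ^ U.card * (U.card.factorial : ℂ))) =
      if U' ⊆ V then (-1 : ℂ) ^ U'.card * (U'.card.factorial : ℂ) else 0 := by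
  classical
  rw [coeff_sum]
  simp only [coeff_monomial]
  have key : ∀ U ∈ V.powerset,
      (if (∑ a ∈ (∅ : Finset (Fin h)), Finsupp.single (Fin.castAdd h a) 1 +
            ∑ c ∈ U, Finsupp.single (Fin.natAdd h c) 1 : Fin (h + h) →₀ ℕ) =
          ∑ a ∈ (∅ : Finset (Fin h)), Finsupp.single (Fin.castAdd h a) 1 +
            ∑ c ∈ U', Finsupp.single (Fin.natAdd h c) 1
        then (-1 : ℂ) ^ U.card * (U.card.factorial : ℂ) else 0) =
      if U = U' then (-1 : ℂ) ^ U'.card * (U'.card.factorial : ℂ) else 0 := by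
    intro U _
    by_cases hU : U = U'
    · subst hU; simp
    · rw [if_neg, if_neg hU]
      intro e
      exact hU ((partitionExpo_eq_iff ∅ U ∅ U').mp e).2
  rw [Finset.sum_congr rfl key, Finset.sum_ite_eq']
  simp only [Finset.mem_powerset]

/-- The truncated inverse `t_V` is `y`-only. -/
theorem yOnly_tinv (V : Finset (Fin h)) :
    ∀ s ∈ (∑ U ∈ V.powerset, monomial (∑ a ∈ (∅ : Finset (Fin h)), Finsupp.single (Fin.castAdd h a) 1 +
          ∑ c ∈ U, Finsupp.single (Fin.natAdd h c) 1) ((-1 : ℂ) ^ U.card * (U.card.factorial : ℂ)) :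
        MvPolynomial (Fin (h + h)) ℂ).support, ∀ a : Fin h, s (Fin.castAdd h a) = 0 := by
  classical
  refine yOnly_sum _ _ fun U _ => yOnly_monomial _ _ fun a => ?_
  rw [partitionExpo_apply_castAdd]
  simp

/-- **`t_V · φ⁰_V ≡ 1` on squarefree monomials**: `coeff (E ∅ U) (t_V · φ⁰_V) = [U = ∅]`
(the identity `(-1)^n n! + n · (-1)^{n-1} (n-1)! = 0`). -/
theorem coeff_tinv_mul_form0 (V U : Finset (Fin h)) :
    coeff (∑ a ∈ (∅ : Finset (Fin h)), Finsupp.single (Fin.castAdd h a) 1 +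
        ∑ c ∈ U, Finsupp.single (Fin.natAdd h c) 1)
        ((∑ U ∈ V.powerset, monomial (∑ a ∈ (∅ : Finset (Fin h)), Finsupp.single (Fin.castAdd h a) 1 +
            ∑ c ∈ U, Finsupp.single (Fin.natAdd h c) 1) ((-1 : ℂ) ^ U.card * (U.card.factorial : ℂ))) *
          (C 1 + ∑ a, C ((fun (_ : Fin h) (_ : Finset (Fin h)) => (0 : ℂ)) a V) * X (Fin.castAdd h a) +
            ∑ c, C (if c ∈ V then (1 : ℂ) else 0) * X (Fin.natAdd h c))) =
      if U = ∅ then 1 else 0 := by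
  classical
  rw [coeff_empty_mul_form, coeff_tinv]
  simp only [coeff_tinv]
  by_cases hU0 : U = ∅
  · subst hU0
    simp
  rw [if_neg hU0]
  by_cases hUV : U ⊆ V
  · rw [if_pos hUV]
    have hterm : ∀ c ∈ U.filter (fun c => c ∈ V),
        (if U.erase c ⊆ V then (-1 : ℂ) ^ (U.erase c).card * ((U.erase c).card.factorial : ℂ) else 0) =
          (-1 : ℂ) ^ (U.card - 1) * ((U.card - 1).factorial : ℂ) := by
      intro c hc
      rw [Finset.mem_filter] at hc
      rw [if_pos ((Finset.erase_subset c U).trans hUV), Finset.card_erase_of_mem hc.1]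
    rw [Finset.sum_congr rfl hterm, Finset.sum_const]
    have hfilt : (U.filter (fun c => c ∈ V)) = U := Finset.filter_true_of_mem (fun c hc => hUV hc)
    rw [hfilt]
    obtain ⟨n, hn⟩ : ∃ n, U.card = n + 1 := ⟨U.card - 1, by
      have := Finset.card_pos.mpr (Finset.nonempty_iff_ne_empty.mpr hU0); omega⟩
    rw [hn, Nat.add_sub_cancel, Nat.factorial_succ, nsmul_eq_mul]
    push_cast
    ring
  · rw [if_neg hUV, zero_add]
    refine Finset.sum_eq_zero fun c hc => ?_
    rw [Finset.mem_filter] at hc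
    rw [if_neg]
    intro hsub
    apply hUV
    intro x hx
    by_cases hxc : x = c
    · rw [hxc]; exact hc.2
    · exact hsub (Finset.mem_erase.mpr ⟨hxc, hx⟩)

/-- **Closed form for the leave-one-out products** (`E_V = B · t_V` on squarefree monomials): for
`V ∈ 𝒦`, `coeff (E ∅ W) (∏_{𝒦 ∖ V} φ⁰) = Σ_{U ⊆ W} coeff (E ∅ (W ∖ U)) (∏_𝒦 φ⁰) · coeff (E ∅ U) t_V`. -/
theorem coeff_leaveOneOut (𝒦 : Finset (Finset (Fin h))) (V : Finset (Fin h)) (hV : V ∈ 𝒦)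
    (W : Finset (Fin h)) :
    coeff (∑ a ∈ (∅ : Finset (Fin h)), Finsupp.single (Fin.castAdd h a) 1 +
        ∑ c ∈ W, Finsupp.single (Fin.natAdd h c) 1)
        (∏ V' ∈ 𝒦.erase V, (C 1 + ∑ a, C ((fun (_ : Fin h) (_ : Finset (Fin h)) => (0 : ℂ)) a V') *
            X (Fin.castAdd h a) + ∑ c, C (if c ∈ V' then (1 : ℂ) else 0) * X (Fin.natAdd h c))) =
      ∑ U ∈ W.powerset,
        coeff (∑ a ∈ (∅ : Finset (Fin h)), Finsupp.single (Fin.castAdd h a) 1 +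
            ∑ c ∈ W \ U, Finsupp.single (Fin.natAdd h c) 1)
          (∏ V' ∈ 𝒦, (C 1 + ∑ a, C ((fun (_ : Fin h) (_ : Finset (Fin h)) => (0 : ℂ)) a V') *
            X (Fin.castAdd h a) + ∑ c, C (if c ∈ V' then (1 : ℂ) else 0) * X (Fin.natAdd h c))) *
        coeff (∑ a ∈ (∅ : Finset (Fin h)), Finsupp.single (Fin.castAdd h a) 1 +
            ∑ c ∈ U, Finsupp.single (Fin.natAdd h c) 1)
          (∑ U' ∈ V.powerset, monomial (∑ a ∈ (∅ : Finset (Fin h)), Finsupp.single (Fin.castAdd h a) 1 +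
            ∑ c ∈ U', Finsupp.single (Fin.natAdd h c) 1)
            ((-1 : ℂ) ^ U'.card * (U'.card.factorial : ℂ))) := by
  classical
  -- `B · t_V`, computed by `coeff_partitionExpo_mul_yOnly`
  rw [← coeff_partitionExpo_mul_yOnly _ _ (yOnly_tinv V) ∅ W]
  -- `B = E_V · φ⁰_V`, so `B · t_V = E_V · (t_V · φ⁰_V)`
  rw [← Finset.prod_erase_mul 𝒦 _ hV, mul_assoc, mul_comm (C 1 + _ + _),
    coeff_partitionExpo_mul_yOnly _ _ (yOnly_mul (yOnly_tinv V) (yOnly_form0 V)) ∅ W]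
  simp_rw [coeff_tinv_mul_form0, mul_ite, mul_one, mul_zero]
  rw [Finset.sum_ite_eq', if_pos (Finset.empty_mem_powerset W), Finset.sdiff_empty]

end Summit.ValiantsHypothesis.ValiantsHypothesis.Theorems.BarrierLever.ChowSubcube
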